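import Literature.NumberTheory.EllipticCurves.PastenHeightBounds
import Literature.NumberTheory.DiophantineGeometry.ConductorFactorizationProofs
import Literature.NumberTheory.DiophantineGeometry.ConductorMultiplicativeProofs
import Literature.NumberTheory.DiophantineGeometry.ConductorExponentZeroProofs
import Literature.NumberTheory.DiophantineGeometry.ConductorExponentLeEightProofs
import Mathlib.Data.Nat.Squarefree
import Mathlib.Data.Nat.GCD.BigOperators
import Mathlib.Algebra.Order.BigOperators.GroupWithZero.Finset
import Mathlib.NumberTheory.ArithmeticFunction.Moebius
import Mathlib.NumberTheory.ArithmeticFunction.Misc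
import Literature.NumberTheory.Sieve.DivisorBound
import HarnessLib

/-!
# Pasten 2024, Thm 1.9 (= Cor 7.8) from Thm 7.7: the choice of an admissible factorisation

Companion proof file of `Literature.NumberTheory.EllipticCurves.PastenHeightBounds` (named fact
`pasten2024_height_lt` = H. Pasten, *Shimura curves and the abc conjecture*, J. Number Theory 254
(2024) 214–335 = arXiv:1705.09251, **Thm 1.9** p. 7 = **Cor 7.8** p. 27, unconditional branch).
It PROVES the printed proof of Cor 7.8 (p. 27), i.e. **Thm 7.7 (unconditional) ⟹ Cor 7.8 =
Thm 1.9**, as `pasten2024_height_lt_of_admissible_bound`, whose hypothesis is Thm 7.7 in the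
Néron-lattice rendering of the parent file: *"For `ε > 0` and `N ≫_ε 1` (with an effective implicit
constant), for each admissible factorization `N = DM` we have the following bounds valid for all
elliptic curves `E` over `ℚ` with conductor `N`: `h(E) < (ε + 1/48) φ(D) M log N` (unconditional)"*
(p. 27), where (p. 12) *"a factorization `N = DM` is admissible if `D, M` are coprime positive
integers with `D` being the product of an even number of distinct prime factors, possibly `D = 1`"*.
Thm 7.7 is NOT vendored (D-0026; its proof — Shimura-curve parametrisations `X₀^D(M) → E`,
Jacquet–Langlands, Ribet–Takahashi Thm 6.1, Thm 5.5, Prop 7.1, Thm 7.2, Thm 7.6, modularity — has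
no counterpart in the tree: `PastenSpectralDegree.lean`, "the case `D > 1` (no Shimura curves in
the tree)"); it enters as an explicit hypothesis stated verbatim, so that `pasten2024_height_lt_holds`
is one line once Thm 7.7 is available.

**The printed proof (p. 27).** *"Let `p_N` be the largest prime factor of `N` away from `S`. [...]
`p_N → ∞` as `N → ∞` by Shafarevich's theorem. [...] If `N` has an even number of prime factors
away from `S`, take `D` to be the product of them. Otherwise, take `D` as the product of them except
`p_N`. Let `M = N/D`, then `φ(D)M = φ(N) ∏_{p∣M}(1 − 1/p)⁻¹ ≤ φ(N) ∏_{p∣p_N P}(1 − 1/p)⁻¹ =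
φ(N) · (p_N/(p_N − 1)) · P/φ(P)`"* (then Thm 7.7 with a smaller `ε`). Transcription:
* `exists_big_primeFactor` ("`p_N → ∞`"): instead of Shafarevich we use `f_p ≤ 8` over `ℚ`
  (`WeierstrassCurve.conductorExponent_le_eight_holds`, Silverman ATAEC IV.10.4): if every prime of
  `N` outside `S` were `≤ B` then `N ∣ (∏_{p ∈ S ∪ {p ≤ B}} p)⁸`.
* `exists_admissible_factorisation`: the choice of `D` (the primes of `N` outside `S` divide `N`
  exactly once by semistability, so `D` is squarefree, `gcd(D, N/D) = 1`, primes of `M` in `S ∪ {q}`).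
* Real bookkeeping: Euler's product `n = φ(n) ∏_{p∣n} p/(p−1)`, monotonicity of `∏ p/(p−1)`,
  `q/(q−1) ≤ (B+1)/B` for `q ≥ B + 1`, `(ε/2 + 1/48)(B+1)/B ≤ ε + 1/48` for `B ≥ 1 + 1/(24ε)`;
  dictionary places of `ℤ` ↔ primes as in `PastenValuationProductSemistableProofs` (`N(𝔭_v) = p_v`,
  `N_E = ∏ p^{f_p}`, semistable at `v` iff `f_v ≤ 1`: the discharged facts of `Conductor.lean`).

**Further steps of the printed proof of Thm 7.7 (pp. 26–27), proved here** (all theorems, no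
new named facts; the deep inputs enter as hypotheses stated verbatim):
* `pasten2024_thm_7_7_of_thm_7_6_of_thm_7_2` — *"Theorem 7.6 together with our bounds for the
  modular degree (cf. Theorems 7.2 and 7.4) give: Theorem 7.7"* (p. 27): Thm 7.7 (unconditional)
  from **Thm 7.6** (`h(E) < (1/2 + ε) log δ_{D,M}(E)`, the Shimura curve approach) and **Thm 7.2**
  (`log δ_{D,M} < (1/24 + ε) φ(D) M log N`), over an ABSTRACT degree function
  `δ : WeierstrassCurve ℚ → ℕ → ℕ → ℝ` standing for `δ_{D,M}(E)` (the optimal quotient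
  `J_0^D(M) → A_{D,M}` is not definable in the tree yet);
  `pasten2024_height_lt_of_thm_7_6_of_thm_7_2` composes it with the Cor 7.8 glue, so that
  `pasten2024_height_lt_holds` is one application once `δ_{D,M}`, Thm 7.6 and Thm 7.2 exist.
* `pasten2024_prop_7_1_of_martin_bound` — **Prop 7.1** (p. 26), the count of systems of Hecke
  eigenvalues `r_{D,M} = Σ_{m∣M} s(Dm) ≤ φ(D)M/12 + (7/12) d(DM²) + 1` from G. Martin's
  `s(n) ≤ φ(n)/12 + (7/12) 2^{ω(n)} + μ(n)` (hypothesis on an arbitrary real sequence `s`; Martin's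
  theorem and `dim S₂(n)^{new}` are not in the tree), via `Σ_{m∣M} φ(m) = M`,
  `Σ_{m∣M} 2^{ω(m)} = d(M²)`, `2^{ω(D)} = d(D)`, `Σ_{m∣M} μ(m) = [M = 1]`; and its asymptotic form
  `r_{D,M} < (1/12 + ε) φ(D) M` for `N = DM ≫_ε 1`
  (`pasten2024_prop_7_1_asymptotic_of_martin_bound`, through `pasten2024_prop_7_1_lowerOrder_le`:
  `(7/12) d(DM²) + 1 ≤ ε φ(D) M`, by the divisor bound `d(n) ≪ n^{1/8}` of `Sieve/DivisorBound`
  and `n ≤ φ(n) d(n)`).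

## References

* H. Pasten, *Shimura curves and the abc conjecture*, J. Number Theory 254 (2024) 214–335,
  arXiv:1705.09251: Thm 1.9 (p. 7), p. 12 (admissible), Thm 7.7, Cor 7.8 and its proof (p. 27).
  [`PastenShimura2024`]
* J. H. Silverman, *Advanced Topics in the Arithmetic of Elliptic Curves*, GTM 151 (1994), IV.10.2,
  IV.10.4. [`Silverman1994`]
* G. Martin, *Dimensions of the spaces of cusp forms and newforms on `Γ₀(N)` and `Γ₁(N)`*,
  J. Number Theory 112 (2005) 298–331, Thm 1 and Lemma 17 (as quoted by Pasten, p. 26; not read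
  here — it enters only as the hypothesis `hs`).
-/

noncomputable section

open WeierstrassCurve IsDedekindDomain Finset Rat.HeightOneSpectrum

namespace Literature.NumberTheory.EllipticCurves.ModularForms

/-! ### Real arithmetic of the Euler factor `∏ p/(p-1)` -/

/-- For a prime `p`: `1 ≤ p/(p−1)` in `ℝ`. [folklore] -/
private theorem one_le_div_pred {p : ℕ} (hp : p.Prime) : (1 : ℝ) ≤ (p : ℝ) / ((p : ℝ) - 1) := by
  have h2 : (2 : ℝ) ≤ p := by exact_mod_cast hp.two_le
  rw [le_div_iff₀ (by linarith)]
  linarith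

/-- `∏_{p ∈ s} p/(p−1) ≤ ∏_{p ∈ t} p/(p−1)` for `s ⊆ t` sets of primes (factors `≥ 1`). [folklore] -/
private theorem prod_div_pred_mono {s t : Finset ℕ} (hst : s ⊆ t) (ht : ∀ p ∈ t, p.Prime) :
    ∏ p ∈ s, ((p : ℝ) / ((p : ℝ) - 1)) ≤ ∏ p ∈ t, ((p : ℝ) / ((p : ℝ) - 1)) :=
  prod_le_prod_of_subset_of_one_le hst
    (fun p hp ↦ zero_le_one.trans (one_le_div_pred (ht p (hst hp))))
    (fun p hp _ ↦ one_le_div_pred (ht p hp))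

/-- **Euler's product formula** in the form `n = φ(n) · ∏_{p ∣ n} p/(p−1)` (all `n`), from
Mathlib's `Nat.totient_mul_prod_primeFactors` (`φ(n) ∏ p = n ∏ (p − 1)`). [folklore] -/
private theorem cast_eq_totient_mul_prod (n : ℕ) :
    (n : ℝ) = (n.totient : ℝ) * ∏ p ∈ n.primeFactors, ((p : ℝ) / ((p : ℝ) - 1)) := by
  have h := Nat.totient_mul_prod_primeFactors n
  have hcast : (n.totient : ℝ) * ∏ p ∈ n.primeFactors, (p : ℝ) =
      (n : ℝ) * ∏ p ∈ n.primeFactors, ((p : ℝ) - 1) := by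
    have h' := congrArg (Nat.cast : ℕ → ℝ) h
    simp only [Nat.cast_mul, Nat.cast_prod] at h'
    rw [h']
    congr 1
    refine prod_congr rfl fun p hp ↦ ?_
    rw [Nat.cast_sub (Nat.prime_of_mem_primeFactors hp).one_le, Nat.cast_one]
  have hpos : 0 < ∏ p ∈ n.primeFactors, ((p : ℝ) - 1) := prod_pos fun p hp ↦ by
    have h2 : (2 : ℝ) ≤ p := by exact_mod_cast (Nat.prime_of_mem_primeFactors hp).two_le
    linarith
  rw [prod_div_distrib, mul_div_assoc', hcast, mul_div_assoc, div_self hpos.ne', mul_one]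

/-- `q/(q−1) ≤ (B+1)/B` for real `1 ≤ B`, `B + 1 ≤ q`. [folklore] -/
private theorem div_pred_le {q B : ℝ} (hB : 1 ≤ B) (hq : B + 1 ≤ q) :
    q / (q - 1) ≤ (B + 1) / B := by
  rw [div_le_div_iff₀ (by linarith) (by linarith)]
  have h : (B + 1) * (q - 1) = q * B + (q - (B + 1)) := by ring
  rw [h]
  linarith

/-- The final bookkeeping of the proof of Cor 7.8: from `h < (ε/2 + 1/48) φ(D) M log N`,
`φ(D) M ≤ φ(N) · ((B+1)/B) · g` and `B ≥ 1 + 1/(24ε)` (so that `(ε/2 + 1/48)(B+1)/B ≤ ε + 1/48`)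
conclude `h < g (ε + 1/48) φ(N) log N`. [folklore] -/
private theorem height_lt_combine {h ε B φD M φN g logN : ℝ} (hε : 0 < ε)
    (hB : 1 + 1 / (24 * ε) ≤ B) (hlt : h < (ε / 2 + 1 / 48) * φD * M * logN)
    (hDM : φD * M ≤ φN * ((B + 1) / B) * g) (hlog : 0 ≤ logN) (hφN : 0 ≤ φN) (hg : 0 ≤ g) :
    h < g * (ε + 1 / 48) * φN * logN := by
  have hε0 : ε ≠ 0 := hε.ne'
  have hBpos : 0 < B := lt_of_lt_of_le (by positivity) hB
  have hconst : (ε / 2 + 1 / 48) * ((B + 1) / B) ≤ ε + 1 / 48 := by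
    rw [mul_div_assoc', div_le_iff₀ hBpos]
    have h1 : ε / 2 * (1 + 1 / (24 * ε)) = ε / 2 + 1 / 48 := by field_simp; ring
    have h2 : ε / 2 * (1 + 1 / (24 * ε)) ≤ ε / 2 * B := mul_le_mul_of_nonneg_left hB (by linarith)
    linarith [h1 ▸ h2]
  have hc0 : (0 : ℝ) ≤ ε / 2 + 1 / 48 := by positivity
  calc h < (ε / 2 + 1 / 48) * φD * M * logN := hlt
    _ = (ε / 2 + 1 / 48) * (φD * M) * logN := by ring
    _ ≤ (ε / 2 + 1 / 48) * (φN * ((B + 1) / B) * g) * logN :=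
        mul_le_mul_of_nonneg_right (mul_le_mul_of_nonneg_left hDM hc0) hlog
    _ = g * ((ε / 2 + 1 / 48) * ((B + 1) / B)) * φN * logN := by ring
    _ ≤ g * (ε + 1 / 48) * φN * logN :=
        mul_le_mul_of_nonneg_right (mul_le_mul_of_nonneg_right
          (mul_le_mul_of_nonneg_left hconst hg) hφN) hlog

/-! ### The two arithmetic steps of the proof of Cor 7.8 -/

/-- `n = ∏_{p ∣ n} p ^ {v_p(n)}` over `n.primeFactors` (`Nat.prod_factorization_pow_eq_self`). [folklore] -/
private theorem prod_primeFactors_pow_factorization {n : ℕ} (hn : n ≠ 0) :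
    ∏ p ∈ n.primeFactors, p ^ n.factorization p = n := by
  conv_rhs => rw [← Nat.prod_factorization_pow_eq_self hn]
  rw [Finsupp.prod, Nat.support_factorization]

/-- **"`p_N → ∞` as `N → ∞`"** (Pasten, proof of Cor 7.8, there via Shafarevich's theorem),
elementary form: if `v_p(N) ≤ 8` for all `p` (conductors over `ℚ`) and
`N > (∏_{p ∈ Sp ∪ {primes ≤ B}} p)⁸`, then `N` has a prime factor `q ∉ Sp` with `q > B` (else
`N ∣ (∏_{p ∈ Sp ∪ {primes ≤ B}} p)⁸`). [cite: PastenShimura2024, Cor 7.8 (proof, p. 27)] -/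
private theorem exists_big_primeFactor {N : ℕ} (hN : N ≠ 0) (Sp : Finset ℕ)
    (hSp : ∀ p ∈ Sp, p.Prime) (B : ℕ) (h8 : ∀ p, N.factorization p ≤ 8)
    (hbig : (∏ p ∈ Sp ∪ (range (B + 1)).filter Nat.Prime, p) ^ 8 < N) :
    ∃ q ∈ N.primeFactors, q ∉ Sp ∧ B < q := by
  classical
  by_contra hcon
  push Not at hcon
  have hsub : N.primeFactors ⊆ Sp ∪ (range (B + 1)).filter Nat.Prime := fun q hq ↦
    (em (q ∈ Sp)).elim (mem_union_left _) fun hqS ↦ mem_union_right _ (mem_filter.2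
      ⟨mem_range.2 (Nat.lt_succ_of_le (hcon q hq hqS)), Nat.prime_of_mem_primeFactors hq⟩)
  have hdvd : N ∣ (∏ p ∈ Sp ∪ (range (B + 1)).filter Nat.Prime, p) ^ 8 :=
    calc N = ∏ p ∈ N.primeFactors, p ^ N.factorization p :=
          (prod_primeFactors_pow_factorization hN).symm
      _ ∣ ∏ p ∈ N.primeFactors, p ^ 8 :=
          prod_dvd_prod_of_dvd _ _ fun p _ ↦ pow_dvd_pow p (h8 p)
      _ ∣ ∏ p ∈ Sp ∪ (range (B + 1)).filter Nat.Prime, p ^ 8 :=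
          prod_dvd_prod_of_subset _ _ _ hsub
      _ = (∏ p ∈ Sp ∪ (range (B + 1)).filter Nat.Prime, p) ^ 8 := prod_pow _ _ _
  have h0 : (∏ p ∈ Sp ∪ (range (B + 1)).filter Nat.Prime, p) ^ 8 ≠ 0 := by
    refine pow_ne_zero _ (prod_ne_zero_iff.2 fun p hp ↦ ?_)
    rcases mem_union.1 hp with hp | hp
    · exact (hSp p hp).ne_zero
    · exact (mem_filter.1 hp).2.ne_zero
  exact absurd (Nat.le_of_dvd (Nat.pos_of_ne_zero h0) hdvd) (not_le.2 hbig)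

/-- **The admissible factorisation of the proof of Cor 7.8** (Pasten p. 27: "If `N` has an even
number of prime factors away from `S`, take `D` to be the product of them. Otherwise, take `D` as
the product of them except `p_N`. Let `M = N/D`"): if every prime of `N` outside `Sp` divides `N`
exactly once (semistability away from `S`) and `q ∉ Sp` is a prime of `N`, there are `D`, `M` with
`N = D M`, `D` squarefree with an even number of prime factors, `gcd(D, M) = 1` (an admissible
factorisation, p. 12), and every prime of `M` in `Sp ∪ {q}`.
[cite: PastenShimura2024, Cor 7.8 (proof, p. 27)] -/
private theorem exists_admissible_factorisation {N : ℕ} (hN : N ≠ 0) (Sp : Finset ℕ)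
    (hsemi : ∀ p ∈ N.primeFactors, p ∉ Sp → N.factorization p = 1)
    {q : ℕ} (hq : q ∈ N.primeFactors) (hqS : q ∉ Sp) :
    ∃ D M : ℕ, N = D * M ∧ Squarefree D ∧ Even D.primeFactors.card ∧ D.Coprime M ∧
      M ≠ 0 ∧ M.primeFactors ⊆ insert q Sp := by
  classical
  -- `T` = the primes of `N` outside `Sp`; `U` = `T` or `T  {q}`, of even cardinality
  set T : Finset ℕ := N.primeFactors.filter (· ∉ Sp)
  have hqT : q ∈ T := mem_filter.2 ⟨hq, hqS⟩
  obtain ⟨U, hUT, hUeven, hTU⟩ :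
      ∃ U : Finset ℕ, U ⊆ T ∧ Even U.card ∧ T ⊆ insert q U := by
    rcases Nat.even_or_odd T.card with he | ho
    · exact ⟨T, Subset.rfl, he, subset_insert _ _⟩
    · refine ⟨T.erase q, erase_subset _ _, ?_, fun p hp ↦ by rwa [insert_erase hqT]⟩
      rw [card_erase_of_mem hqT]
      exact ho.imp fun k hk ↦ by omega
  have hUpf : U ⊆ N.primeFactors := hUT.trans (filter_subset _ _)
  have hUprime : ∀ p ∈ U, p.Prime := fun p hp ↦ Nat.prime_of_mem_primeFactors (hUpf hp)
  have hUfac : ∀ p ∈ U, N.factorization p = 1 := fun p hp ↦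
    hsemi p (hUpf hp) (mem_filter.1 (hUT hp)).2
  refine ⟨∏ p ∈ U, p, ∏ p ∈ N.primeFactors \ U, p ^ N.factorization p, ?_, ?_, ?_, ?_, ?_, ?_⟩
  · -- `N = D * M`
    calc N = ∏ p ∈ N.primeFactors, p ^ N.factorization p :=
          (prod_primeFactors_pow_factorization hN).symm
      _ = (∏ p ∈ U, p ^ N.factorization p) * ∏ p ∈ N.primeFactors \ U, p ^ N.factorization p := by
          rw [← prod_sdiff hUpf, mul_comm]
      _ = (∏ p ∈ U, p) * ∏ p ∈ N.primeFactors \ U, p ^ N.factorization p := by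
          congr 1
          exact prod_congr rfl fun p hp ↦ by rw [hUfac p hp, pow_one]
  · -- `D` is squarefree: a product of distinct primes
    exact Finset.squarefree_prod_of_pairwise_isCoprime
      (fun p hp r hr hpr ↦ Nat.coprime_iff_isRelPrime.1
        ((Nat.coprime_primes (hUprime p hp) (hUprime r hr)).2 hpr))
      (fun p hp ↦ (hUprime p hp).prime.squarefree)
  · rwa [Nat.primeFactors_prod hUprime]
  · -- `gcd(D, M) = 1`
    refine Nat.Coprime.prod_left fun p hp ↦ Nat.Coprime.prod_right fun r hr ↦ ?_
    have hpr : p ≠ r := fun h ↦ (mem_sdiff.1 hr).2 (h ▸ hp)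
    exact ((Nat.coprime_primes (hUprime p hp)
      (Nat.prime_of_mem_primeFactors (mem_sdiff.1 hr).1)).2 hpr).pow_right _
  · exact prod_ne_zero_iff.2 fun p hp ↦
      pow_ne_zero _ (Nat.prime_of_mem_primeFactors (mem_sdiff.1 hp).1).ne_zero
  · -- every prime of `M` is in `Sp ∪ {q}`
    intro r hr
    have hrprime := Nat.prime_of_mem_primeFactors hr
    obtain ⟨p, hp, hrp⟩ := (hrprime.prime.dvd_finsetProd_iff _).1 (Nat.dvd_of_mem_primeFactors hr)
    have hp' := mem_sdiff.1 hp
    have hr_eq : r = p :=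
      (Nat.prime_dvd_prime_iff_eq hrprime (Nat.prime_of_mem_primeFactors hp'.1)).1
        (hrprime.dvd_of_dvd_pow hrp)
    subst hr_eq
    by_cases hrS : r ∈ Sp
    · exact mem_insert_of_mem hrS
    · rcases mem_insert.1 (hTU (mem_filter.2 ⟨hp'.1, hrS⟩)) with rfl | h
      · exact mem_insert_self _ _
      · exact absurd h hp'.2

/-! ### Dictionary: places of `ℤ`, rational primes, the conductor -/

section Dictionary

/-- `natGenerator : HeightOneSpectrum ℤ → ℕ` is injective (via `primesEquiv`). [folklore] -/
private theorem natGenerator_injective' : Function.Injective (natGenerator (R := ℤ)) :=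
  fun _ _ h ↦ primesEquiv.injective (Subtype.ext h)

/-- The rational prime below the place `primesEquiv.symm p` is `p`. [folklore] -/
private theorem natGenerator_primesEquiv_symm' (p : Nat.Primes) :
    natGenerator ((primesEquiv (R := ℤ)).symm p) = p :=
  congrArg Subtype.val ((primesEquiv (R := ℤ)).apply_symm_apply p)

/-- Over `ℤ`: `N (𝔭_v) = p_v`, the absolute norm of a height-one prime is the rational prime
generating it (`span_natGenerator`, `Ideal.absNorm_span_natCast`). [folklore] -/
private theorem absNorm_asIdeal_eq_natGenerator' (v : HeightOneSpectrum ℤ) :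
    Ideal.absNorm v.asIdeal = natGenerator v := by
  have h : v.asIdeal = Ideal.span {(natGenerator v : ℤ)} := by
    rw [span_natGenerator, ← Ideal.comap_symm]
    ext x
    rw [Ideal.mem_comap, eq_intCast, Int.cast_id]
  rw [h, Ideal.absNorm_span_natCast, Module.finrank_self, pow_one]

/-- `∏_{v ∈ S} N(𝔭_v) = ∏_{p ∈ p(S)} p`: the product of the primes of `S`. [folklore] -/
private theorem prod_absNorm_eq (S : Finset (HeightOneSpectrum ℤ)) :
    ∏ v ∈ S, Ideal.absNorm v.asIdeal = ∏ p ∈ S.image natGenerator, p := by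
  rw [prod_image fun v _ w _ h ↦ natGenerator_injective' h]
  exact prod_congr rfl fun v _ ↦ absNorm_asIdeal_eq_natGenerator' v

variable (W : WeierstrassCurve ℚ) [W.IsElliptic]

/-- `v_p(N_E) = f_{v_p}` at the place `v_p = primesEquiv.symm p` above the prime `p`
(`factorization_conductorNorm_holds`, Silverman AEC C.16). [folklore] -/
private theorem factorization_primesEquiv_symm (p : Nat.Primes) :
    (W.conductorNorm ℤ).factorization p = W.conductorExponent ((primesEquiv (R := ℤ)).symm p) := by
  have h : (W.conductorNorm ℤ).factorization (natGenerator ((primesEquiv (R := ℤ)).symm p)) =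
      W.conductorExponent ((primesEquiv (R := ℤ)).symm p) :=
    WeierstrassCurve.factorization_conductorNorm_holds W _
  rwa [natGenerator_primesEquiv_symm'] at h

/-- Semistable at `v` iff `f_v ≤ 1` (good: `f_v = 0`, multiplicative: `f_v = 1`; Silverman ATAEC
IV.10.2 (a),(b), the discharged `conductorExponent_eq_{zero,one}_iff_holds`). [cite: Silverman1994, IV.10.2] -/
private theorem isSemistableAt_iff_conductorExponent_le_one' (v : HeightOneSpectrum ℤ) :
    W.IsSemistableAt v ↔ W.conductorExponent v ≤ 1 := by
  have h0 : W.conductorExponent v = 0 ↔ W.HasGoodReductionAt v :=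
    WeierstrassCurve.conductorExponent_eq_zero_iff_holds v W
  have h1 : W.conductorExponent v = 1 ↔ W.HasMultiplicativeReductionAt v :=
    WeierstrassCurve.conductorExponent_eq_one_iff_holds v W
  rw [WeierstrassCurve.IsSemistableAt, ← h0, ← h1]
  omega

/-- `v_p(N_E) ≤ 8` for every `p` (Silverman ATAEC IV.10.4: `f_p ≤ 8` over `ℚ`, the discharged
`conductorExponent_le_eight_holds`). [cite: Silverman1994, IV.10.4] -/
private theorem factorization_conductorNorm_le_eight (p : ℕ) :
    (W.conductorNorm ℤ).factorization p ≤ 8 := by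
  by_cases hp : p.Prime
  · rw [factorization_primesEquiv_symm W ⟨p, hp⟩]
    exact WeierstrassCurve.conductorExponent_le_eight_holds W _
  · exact (Nat.factorization_eq_zero_of_not_prime _ hp).trans_le (Nat.zero_le _)

/-- Semi-stable away from `S` ⇒ every prime of `N_E` outside the primes of `S` divides `N_E`
exactly once (`f_p = 1`). [cite: Silverman1994, IV.10.2] -/
private theorem factorization_conductorNorm_eq_one (S : Finset (HeightOneSpectrum ℤ))
    (hss : ∀ v : HeightOneSpectrum ℤ, v ∉ S → W.IsSemistableAt v) {p : ℕ}
    (hp : p ∈ (W.conductorNorm ℤ).primeFactors) (hpS : p ∉ S.image natGenerator) :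
    (W.conductorNorm ℤ).factorization p = 1 := by
  have hpprime := Nat.prime_of_mem_primeFactors hp
  have hvS : (primesEquiv (R := ℤ)).symm ⟨p, hpprime⟩ ∉ S := fun h ↦
    hpS (mem_image.2 ⟨_, h, natGenerator_primesEquiv_symm' ⟨p, hpprime⟩⟩)
  have hle : (W.conductorNorm ℤ).factorization p ≤ 1 := by
    rw [factorization_primesEquiv_symm W ⟨p, hpprime⟩]
    exact (isSemistableAt_iff_conductorExponent_le_one' W _).1 (hss _ hvS)
  have hN : 0 < W.conductorNorm ℤ := WeierstrassCurve.conductorNorm_pos_holds W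
  have hpos : 0 < (W.conductorNorm ℤ).factorization p :=
    hpprime.factorization_pos_of_dvd hN.ne' (Nat.dvd_of_mem_primeFactors hp)
  omega

end Dictionary

/-! ### Theorem 1.9 (= Corollary 7.8) from Theorem 7.7 -/

/-- **Pasten 2024, Cor 7.8 (= Thm 1.9, unconditional branch) from Thm 7.7 (unconditional
branch)** — the printed proof of Cor 7.8 (p. 27), formalised. Hypothesis `h77` is Thm 7.7,
unconditional case, in the rendering of `pasten2024_height_lt`: *"For `ε > 0` and `N ≫_ε 1` (with
an effective implicit constant), for each admissible factorization `N = DM` we have the following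
bounds valid for all elliptic curves `E` over `ℚ` with conductor `N`:
`h(E) < (ε + 1/48) φ(D) M log N` (unconditional)"*, admissible meaning (p. 12) `N = DM`,
`gcd(D, M) = 1`, `D` the product of an even number of distinct primes (possibly `D = 1`);
`h(E) = neronLatticeHeight L` for the Néron lattice `L` of a global minimal model `W`,
`N = W.conductorNorm ℤ`, `φ = Nat.totient`. Conclusion: the named fact `pasten2024_height_lt`.
Proof as printed (module docstring): Thm 7.7 with `ε/2` for `D = ∏ {p ∣ N, p ∉ S}` (dropping a
prime `q > B` of `N` outside `S` if the number of such primes is odd), for which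
`φ(D) M = φ(N) ∏_{p∣M} p/(p−1) ≤ φ(N) (q/(q−1)) P/φ(P) ≤ φ(N) ((B+1)/B) P/φ(P)`,
`B ≥ 1 + 1/(24ε)`, `N > (∏_{p ∈ S ∪ {p ≤ B}} p)⁸`. Thm 7.7 is not in the tree (Shimura curves),
whence the hypothesis. [cite: PastenShimura2024, Cor 7.8 (proof, p. 27) and Thm 7.7] -/
theorem pasten2024_height_lt_of_admissible_bound
    (h77 : ∀ ε : ℝ, 0 < ε → ∃ N₀ : ℕ,
      ∀ (W : WeierstrassCurve ℚ) [W.IsElliptic] [W.IsGloballyMinimal] (L : PeriodPair),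
        IsNeronLatticeOf (W.baseChange ℂ) L →
        ∀ D M : ℕ, W.conductorNorm ℤ = D * M → Squarefree D → Even D.primeFactors.card →
          D.Coprime M → N₀ ≤ W.conductorNorm ℤ →
            neronLatticeHeight L <
              (ε + 1 / 48) * (Nat.totient D : ℝ) * (M : ℝ) * Real.log (W.conductorNorm ℤ)) :
    pasten2024_height_lt := by
  classical
  intro S ε hε
  -- the primes of `S` and their product `P`
  set Sp : Finset ℕ := S.image natGenerator
  have hSp : ∀ p ∈ Sp, p.Prime := fun p hp ↦ by
    obtain ⟨v, -, rfl⟩ := mem_image.1 hp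
    exact prime_natGenerator v
  set P : ℕ := ∏ p ∈ Sp, p
  have hP0 : P ≠ 0 := prod_ne_zero_iff.2 fun p hp ↦ (hSp p hp).ne_zero
  have hPpf : P.primeFactors = Sp := Nat.primeFactors_prod hSp
  have hPeq : ∏ v ∈ S, Ideal.absNorm v.asIdeal = P := prod_absNorm_eq S
  have hPreal : (∏ v ∈ S, (Ideal.absNorm v.asIdeal : ℝ)) = (P : ℝ) := by
    rw [← hPeq, Nat.cast_prod]
  -- Thm 7.7 with `ε/2`; the threshold `B` for `q/(q-1) ≤ (B+1)/B`; the size `N₂` forcing `q > B`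
  obtain ⟨N₁, hN₁⟩ := h77 (ε / 2) (half_pos hε)
  set B : ℕ := ⌈1 + 1 / (24 * ε)⌉₊
  have hB1 : (1 : ℝ) + 1 / (24 * ε) ≤ B := Nat.le_ceil _
  have hB1' : (1 : ℝ) ≤ B := (le_add_of_nonneg_right (by positivity)).trans hB1
  set N₂ : ℕ := (∏ p ∈ Sp ∪ (range (B + 1)).filter Nat.Prime, p) ^ 8
  refine ⟨max N₁ (N₂ + 1), fun W _ _ L hL hss hN ↦ ?_⟩
  rw [hPreal, hPeq]
  have hN1 : N₁ ≤ W.conductorNorm ℤ := le_of_max_le_left hN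
  have hN2 : N₂ < W.conductorNorm ℤ := Nat.lt_of_succ_le (le_of_max_le_right hN)
  have hN0 : W.conductorNorm ℤ ≠ 0 :=
    (WeierstrassCurve.conductorNorm_pos_holds W : 0 < W.conductorNorm ℤ).ne'
  -- a prime `q ∣ N` outside `S` with `q > B`
  obtain ⟨q, hq, hqS, hBq⟩ := exists_big_primeFactor hN0 Sp hSp B
    (factorization_conductorNorm_le_eight W) hN2
  have hqprime : q.Prime := Nat.prime_of_mem_primeFactors hq
  -- the admissible factorisation `N = D M`
  obtain ⟨D, M, hNDM, hDsq, hDeven, hDM, hM0, hMpf⟩ := exists_admissible_factorisation hN0 Sp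
    (fun p hp hpS ↦ factorization_conductorNorm_eq_one W S hss hp hpS) hq hqS
  -- Thm 7.7 for this factorisation
  have hlt := hN₁ W L hL D M hNDM hDsq hDeven hDM hN1
  -- `φ(D) M ≤ φ(N) · ((B+1)/B) · P/φ(P)`
  have hφDM : (D.totient : ℝ) * M ≤
      ((W.conductorNorm ℤ).totient : ℝ) * (((B : ℝ) + 1) / B) * ((P : ℝ) / (P.totient : ℝ)) := by
    have hM := cast_eq_totient_mul_prod M
    have hφN : ((W.conductorNorm ℤ).totient : ℝ) = D.totient * M.totient := by
      rw [hNDM, Nat.totient_mul hDM, Nat.cast_mul]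
    have hg : ∏ p ∈ M.primeFactors, ((p : ℝ) / ((p : ℝ) - 1)) ≤
        (q : ℝ) / ((q : ℝ) - 1) * ∏ p ∈ Sp, ((p : ℝ) / ((p : ℝ) - 1)) :=
      (prod_div_pred_mono hMpf fun p hp ↦ by
        rcases mem_insert.1 hp with rfl | hp
        exacts [hqprime, hSp p hp]).trans (prod_insert hqS).le
    have hgP : ∏ p ∈ Sp, ((p : ℝ) / ((p : ℝ) - 1)) = (P : ℝ) / (P.totient : ℝ) := by
      have hPc := cast_eq_totient_mul_prod P
      have hφP : (0 : ℝ) < P.totient := by exact_mod_cast Nat.totient_pos.2 (Nat.pos_of_ne_zero hP0)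
      rw [hPpf] at hPc
      rw [eq_div_iff hφP.ne', mul_comm, ← hPc]
    have hq3 : (q : ℝ) / ((q : ℝ) - 1) ≤ ((B : ℝ) + 1) / B :=
      div_pred_le hB1' (by exact_mod_cast Nat.succ_le_of_lt hBq)
    have hgS0 : 0 ≤ ∏ p ∈ Sp, ((p : ℝ) / ((p : ℝ) - 1)) :=
      prod_nonneg fun p hp ↦ zero_le_one.trans (one_le_div_pred (hSp p hp))
    calc (D.totient : ℝ) * M
        = D.totient * (M.totient * ∏ p ∈ M.primeFactors, ((p : ℝ) / ((p : ℝ) - 1))) := by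
          rw [← hM]
      _ ≤ D.totient * (M.totient *
            (((B : ℝ) + 1) / B * ∏ p ∈ Sp, ((p : ℝ) / ((p : ℝ) - 1)))) :=
          mul_le_mul_of_nonneg_left (mul_le_mul_of_nonneg_left
            (hg.trans (mul_le_mul_of_nonneg_right hq3 hgS0)) (Nat.cast_nonneg _))
            (Nat.cast_nonneg _)
      _ = ((W.conductorNorm ℤ).totient : ℝ) * (((B : ℝ) + 1) / B) * ((P : ℝ) / (P.totient : ℝ)) := by
          rw [hφN, hgP]; ring
  -- conclude
  exact height_lt_combine hε hB1 hlt hφDM (Real.log_natCast_nonneg _) (Nat.cast_nonneg _)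
    (by positivity)

/-! ### Theorem 7.7 from Theorem 7.6 (the Shimura curve approach) and Theorem 7.2 (degree bound) -/

/-- The `ε`-bookkeeping of Thm 7.7: with `η = min ε 1 / 2`, `(1/2 + η)(1/24 + η) ≤ ε + 1/48`.
[folklore] -/
private theorem half_add_mul_le {ε : ℝ} (hε : 0 < ε) :
    (1 / 2 + min ε 1 / 2) * (1 / 24 + min ε 1 / 2) ≤ ε + 1 / 48 := by
  have h1 : min ε 1 ≤ ε := min_le_left _ _
  have h2 : min ε 1 ≤ 1 := min_le_right _ _
  have h0 : 0 < min ε 1 := lt_min hε one_pos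
  nlinarith [mul_nonneg h0.le (sub_nonneg.2 h2)]

/-- **Pasten 2024, Thm 7.7 (unconditional branch) from Thm 7.6 and Thm 7.2** — the printed
derivation (p. 27: *"Theorem 7.6 together with our bounds for the modular degree (cf. Theorems 7.2
and 7.4) give: Theorem 7.7"*), formalised over an ABSTRACT degree function
`δ : (global minimal model) → D → M → ℝ` standing for the degree `δ_{D,M}(E)` of the optimal
Shimura-curve quotient `J_0^D(M) → A_{D,M}` (§4, §6; not definable in the tree yet — no Shimura
curves `X_0^D(M)`), so that the two deep inputs enter as hypotheses stated verbatim for that `δ`: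
* `h76` = **Thm 7.6** (the Shimura curve approach to `abc`, height half): *"Let `ε > 0`. For all
  elliptic curves `E` of conductor `N ≫_ε 1` [...] and for any admissible factorization `N = DM`
  we have [...] `h(E) < (1/2 + ε) log δ_{D,M}(E)`"* (p. 27);
* `h72` = **Thm 7.2** (asymptotic form): *"given any `ε > 0`, for `N ≫_ε 1` [...]
  `log δ_{D,M} < (1/24 + ε) φ(D) M log N`"* (p. 26), for every elliptic curve `E/ℚ` of conductor
  `N` and admissible `N = DM`;
and the conclusion is Thm 7.7, unconditional case: *"`h(E) < (ε + 1/48) φ(D) M log N`"* — exactly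
the hypothesis `h77` of `pasten2024_height_lt_of_admissible_bound`. Admissible (p. 12): `N = DM`,
`gcd(D, M) = 1`, `D` squarefree with an even number of prime factors; `h(E) = neronLatticeHeight L`
(Néron lattice of a global minimal model), `N = W.conductorNorm ℤ`. Proof: both inputs with
`η = min ε 1 / 2`, `(1/2 + η)(1/24 + η) ≤ ε + 1/48`, `φ(D) M log N ≥ 0`.
[cite: PastenShimura2024, Thm 7.7 (proof, p. 27) from Thm 7.6 and Thm 7.2] -/
theorem pasten2024_thm_7_7_of_thm_7_6_of_thm_7_2 (δ : WeierstrassCurve ℚ → ℕ → ℕ → ℝ)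
    (h76 : ∀ ε : ℝ, 0 < ε → ∃ N₁ : ℕ,
      ∀ (W : WeierstrassCurve ℚ) [W.IsElliptic] [W.IsGloballyMinimal] (L : PeriodPair),
        IsNeronLatticeOf (W.baseChange ℂ) L →
        ∀ D M : ℕ, W.conductorNorm ℤ = D * M → Squarefree D → Even D.primeFactors.card →
          D.Coprime M → N₁ ≤ W.conductorNorm ℤ →
            neronLatticeHeight L < (1 / 2 + ε) * Real.log (δ W D M))
    (h72 : ∀ ε : ℝ, 0 < ε → ∃ N₂ : ℕ,
      ∀ (W : WeierstrassCurve ℚ) [W.IsElliptic],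
        ∀ D M : ℕ, W.conductorNorm ℤ = D * M → Squarefree D → Even D.primeFactors.card →
          D.Coprime M → N₂ ≤ W.conductorNorm ℤ →
            Real.log (δ W D M) <
              (1 / 24 + ε) * (Nat.totient D : ℝ) * (M : ℝ) * Real.log (W.conductorNorm ℤ)) :
    ∀ ε : ℝ, 0 < ε → ∃ N₀ : ℕ,
      ∀ (W : WeierstrassCurve ℚ) [W.IsElliptic] [W.IsGloballyMinimal] (L : PeriodPair),
        IsNeronLatticeOf (W.baseChange ℂ) L →
        ∀ D M : ℕ, W.conductorNorm ℤ = D * M → Squarefree D → Even D.primeFactors.card →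
          D.Coprime M → N₀ ≤ W.conductorNorm ℤ →
            neronLatticeHeight L <
              (ε + 1 / 48) * (Nat.totient D : ℝ) * (M : ℝ) * Real.log (W.conductorNorm ℤ) := by
  intro ε hε
  set η : ℝ := min ε 1 / 2
  have hη0 : 0 < η := div_pos (lt_min hε one_pos) two_pos
  obtain ⟨N₁, hN₁⟩ := h76 η hη0
  obtain ⟨N₂, hN₂⟩ := h72 η hη0
  refine ⟨max N₁ N₂, fun W _ _ L hL D M hN hD hDe hDM hN0 ↦ ?_⟩
  have h1 := hN₁ W L hL D M hN hD hDe hDM (le_of_max_le_left hN0)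
  have h2 := hN₂ W D M hN hD hDe hDM (le_of_max_le_right hN0)
  have hlog : 0 ≤ Real.log (W.conductorNorm ℤ) := Real.log_natCast_nonneg _
  have hX : 0 ≤ (Nat.totient D : ℝ) * (M : ℝ) * Real.log (W.conductorNorm ℤ) := by positivity
  calc neronLatticeHeight L < (1 / 2 + η) * Real.log (δ W D M) := h1
    _ < (1 / 2 + η) *
          ((1 / 24 + η) * (Nat.totient D : ℝ) * (M : ℝ) * Real.log (W.conductorNorm ℤ)) :=
        mul_lt_mul_of_pos_left h2 (by positivity)
    _ = (1 / 2 + η) * (1 / 24 + η) *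
          ((Nat.totient D : ℝ) * (M : ℝ) * Real.log (W.conductorNorm ℤ)) := by ring
    _ ≤ (ε + 1 / 48) * ((Nat.totient D : ℝ) * (M : ℝ) * Real.log (W.conductorNorm ℤ)) :=
        mul_le_mul_of_nonneg_right (half_add_mul_le hε) hX
    _ = (ε + 1 / 48) * (Nat.totient D : ℝ) * (M : ℝ) * Real.log (W.conductorNorm ℤ) := by ring

/-- **Pasten 2024, Thm 1.9 (= Cor 7.8, unconditional) from Thm 7.6 and Thm 7.2**: the whole
printed chain Thm 7.6 + Thm 7.2 ⟹ Thm 7.7 ⟹ Cor 7.8 (pp. 26–27), for an abstract degree function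
`δ` (see `pasten2024_thm_7_7_of_thm_7_6_of_thm_7_2`) composed with the landed choice of an
admissible factorisation (`pasten2024_height_lt_of_admissible_bound`). Once `δ_{D,M}` is defined
and Thms 7.6, 7.2 are available for it, `pasten2024_height_lt_holds` is this theorem applied to
them. [cite: PastenShimura2024, Thm 7.6, Thm 7.2, Thm 7.7, Cor 7.8 (pp. 26–27)] -/
theorem pasten2024_height_lt_of_thm_7_6_of_thm_7_2 (δ : WeierstrassCurve ℚ → ℕ → ℕ → ℝ)
    (h76 : ∀ ε : ℝ, 0 < ε → ∃ N₁ : ℕ,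
      ∀ (W : WeierstrassCurve ℚ) [W.IsElliptic] [W.IsGloballyMinimal] (L : PeriodPair),
        IsNeronLatticeOf (W.baseChange ℂ) L →
        ∀ D M : ℕ, W.conductorNorm ℤ = D * M → Squarefree D → Even D.primeFactors.card →
          D.Coprime M → N₁ ≤ W.conductorNorm ℤ →
            neronLatticeHeight L < (1 / 2 + ε) * Real.log (δ W D M))
    (h72 : ∀ ε : ℝ, 0 < ε → ∃ N₂ : ℕ,
      ∀ (W : WeierstrassCurve ℚ) [W.IsElliptic],
        ∀ D M : ℕ, W.conductorNorm ℤ = D * M → Squarefree D → Even D.primeFactors.card →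
          D.Coprime M → N₂ ≤ W.conductorNorm ℤ →
            Real.log (δ W D M) <
              (1 / 24 + ε) * (Nat.totient D : ℝ) * (M : ℝ) * Real.log (W.conductorNorm ℤ)) :
    pasten2024_height_lt :=
  pasten2024_height_lt_of_admissible_bound (pasten2024_thm_7_7_of_thm_7_6_of_thm_7_2 δ h76 h72)

/-! ### Proposition 7.1: counting systems of Hecke eigenvalues (the arithmetic of the bound) -/

section Prop71

open ArithmeticFunction

open scoped ArithmeticFunction.Moebius ArithmeticFunction.zeta

/-- `d(D) = 2^{ω(D)}` for squarefree `D`. [folklore] -/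
private theorem card_divisors_of_squarefree' {D : ℕ} (hD : Squarefree D) :
    D.divisors.card = 2 ^ D.primeFactors.card := by
  rw [Nat.card_divisors hD.ne_zero, ← Finset.prod_const]
  refine Finset.prod_congr rfl fun p hp ↦ ?_
  have h1 : D.factorization p ≤ 1 := hD.natFactorization_le_one p
  have h2 : 0 < D.factorization p :=
    (Nat.prime_of_mem_primeFactors hp).factorization_pos_of_dvd hD.ne_zero
      (Nat.dvd_of_mem_primeFactors hp)
  omega

/-- `Σ_{m ∣ M} 2^{ω(m)} = d(M²)` (`M ≠ 0`): both sides are multiplicative (`2^{ω}` is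
`prodPrimeFactors (fun _ ↦ 2)`) and equal `2k + 1` at `p^k`. [folklore] -/
private theorem sum_divisors_two_pow_card_primeFactors {M : ℕ} (hM : M ≠ 0) :
    ∑ m ∈ M.divisors, 2 ^ m.primeFactors.card = (M ^ 2).divisors.card := by
  set F : ArithmeticFunction ℕ := prodPrimeFactors fun _ ↦ 2 with hF
  have hFapp : ∀ n ≠ 0, F n = 2 ^ n.primeFactors.card := fun n hn ↦ by
    rw [hF, prodPrimeFactors_apply hn, Finset.prod_const]
  have hFmult : (F * ζ).IsMultiplicative :=
    (IsMultiplicative.prodPrimeFactors _).mul isMultiplicative_zeta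
  have hlhs : ∑ m ∈ M.divisors, 2 ^ m.primeFactors.card = (F * ζ) M := by
    rw [mul_zeta_apply]
    exact Finset.sum_congr rfl fun m hm ↦ (hFapp m (Nat.pos_of_mem_divisors hm).ne').symm
  rw [hlhs, IsMultiplicative.multiplicative_factorization _ hFmult hM,
    Nat.card_divisors (pow_ne_zero 2 hM), Nat.primeFactors_pow _ two_ne_zero, Nat.factorization_pow,
    Finsupp.prod, Nat.support_factorization]
  refine Finset.prod_congr rfl fun p hp ↦ ?_
  have hp' := Nat.prime_of_mem_primeFactors hp
  rw [mul_zeta_apply, Nat.sum_divisors_prime_pow hp', Finsupp.smul_apply, smul_eq_mul,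
    Finset.sum_range_succ', pow_zero, hFapp 1 one_ne_zero, Nat.primeFactors_one, Finset.card_empty,
    pow_zero]
  have h2 : ∀ i ∈ Finset.range (M.factorization p), F (p ^ (i + 1)) = 2 := fun i _ ↦ by
    rw [hFapp _ (pow_ne_zero _ hp'.ne_zero), Nat.primeFactors_prime_pow (Nat.succ_ne_zero i) hp',
      Finset.card_singleton, pow_one]
  rw [Finset.sum_congr rfl h2, Finset.sum_const, Finset.card_range, smul_eq_mul]
  ring

/-- `Σ_{m ∣ M} μ(D m) = μ(D) · [M = 1] ≤ 1` for `gcd(D, M) = 1`. [folklore] -/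
private theorem sum_divisors_moebius_mul_le {D M : ℕ} (hDM : D.Coprime M) :
    ∑ m ∈ M.divisors, (μ (D * m) : ℝ) ≤ 1 := by
  have hmul : ∀ m ∈ M.divisors, μ (D * m) = μ D * μ m := fun m hm ↦
    isMultiplicative_moebius.map_mul_of_coprime
      (hDM.coprime_dvd_right (Nat.dvd_of_mem_divisors hm))
  have hsum : ∑ m ∈ M.divisors, μ m = if M = 1 then 1 else 0 := by
    have h := congrArg (fun f : ArithmeticFunction ℤ ↦ f M) moebius_mul_coe_zeta
    simpa only [coe_mul_zeta_apply, one_apply] using h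
  have hint : ∑ m ∈ M.divisors, μ (D * m) ≤ 1 := by
    rw [Finset.sum_congr rfl hmul, ← Finset.mul_sum, hsum]
    have hD : |μ D| ≤ 1 := abs_moebius_le_one
    split_ifs
    · rw [mul_one]; exact (le_abs_self _).trans hD
    · rw [mul_zero]; exact zero_le_one
  exact_mod_cast hint

/-- **Pasten 2024, Prop 7.1 (the counting bound), arithmetic content.** With
`s(n) = dim S₂(n)^{new}` and `r_{D,M} = Σ_{m ∣ M} s(Dm)` the number of systems of Hecke
eigenvalues on `𝕋_{D,M}` (multiplicity one + Jacquet–Langlands, p. 26), G. Martin's bound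
`s(n) ≤ φ(n)/12 + (7/12)·2^{ω(n)} + μ(n)` ([GregMartin] Thm 1 with Lemma 17, as quoted p. 26)
gives, since "the functions `φ, 2^ω, μ` are multiplicative, `(D,M) = 1` and `D` is squarefree",
`r_{D,M} ≤ (φ(D)/12) Σ_{m∣M} φ(m) + (7·2^{ω(D)}/12) Σ_{m∣M} 2^{ω(m)} + μ(D) Σ_{m∣M} μ(m)
≤ (1/12) φ(D) M + (7/12) d(D M²) + 1` — **Prop 7.1**: *"We have
`r_{D,M} ≤ (1/12)·φ(D)M + (7/12)·d(DM²) + 1`."* Formalised for an ARBITRARY real sequence `s`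
satisfying Martin's bound (hypothesis `hs`; the dimension of the new subspace and Martin's theorem
are not in the tree), `D` squarefree, `M ≠ 0`, `gcd(D, M) = 1`; ingredients `Σ_{m∣M} φ(m) = M`,
`Σ_{m∣M} 2^{ω(m)} = d(M²)`, `2^{ω(D)} = d(D)`, `d(D) d(M²) = d(DM²)`, `Σ_{m∣M} μ(m) = [M = 1]`.
[cite: PastenShimura2024, Prop 7.1 (and the display before it, p. 26)] -/
theorem pasten2024_prop_7_1_of_martin_bound (s : ℕ → ℝ)
    (hs : ∀ n : ℕ, n ≠ 0 →
      s n ≤ (Nat.totient n : ℝ) / 12 + 7 / 12 * 2 ^ n.primeFactors.card + (μ n : ℝ))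
    {D M : ℕ} (hD : Squarefree D) (hM : M ≠ 0) (hDM : D.Coprime M) :
    ∑ m ∈ M.divisors, s (D * m) ≤
      (Nat.totient D : ℝ) * M / 12 + 7 / 12 * ((D * M ^ 2).divisors.card : ℝ) + 1 := by
  have hD0 : D ≠ 0 := hD.ne_zero
  have h1 : ∑ m ∈ M.divisors, s (D * m) ≤ ∑ m ∈ M.divisors,
      ((Nat.totient (D * m) : ℝ) / 12 + 7 / 12 * 2 ^ (D * m).primeFactors.card +
        (μ (D * m) : ℝ)) :=
    Finset.sum_le_sum fun m hm ↦ hs _ (mul_ne_zero hD0 (Nat.pos_of_mem_divisors hm).ne')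
  have heq : ∑ m ∈ M.divisors, ((Nat.totient (D * m) : ℝ) / 12 +
      7 / 12 * 2 ^ (D * m).primeFactors.card + (μ (D * m) : ℝ)) =
      (∑ m ∈ M.divisors, (Nat.totient (D * m) : ℝ)) / 12 +
        7 / 12 * ∑ m ∈ M.divisors, (2 : ℝ) ^ (D * m).primeFactors.card +
        ∑ m ∈ M.divisors, (μ (D * m) : ℝ) := by
    rw [Finset.sum_add_distrib, Finset.sum_add_distrib, Finset.sum_div, Finset.mul_sum]
  -- `Σ φ(Dm) = φ(D) M`
  have hφ : ∑ m ∈ M.divisors, (Nat.totient (D * m) : ℝ) = (Nat.totient D : ℝ) * M := by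
    have h : ∑ m ∈ M.divisors, Nat.totient (D * m) =
        Nat.totient D * ∑ m ∈ M.divisors, Nat.totient m := by
      rw [Finset.mul_sum]
      exact Finset.sum_congr rfl fun m hm ↦
        Nat.totient_mul (hDM.coprime_dvd_right (Nat.dvd_of_mem_divisors hm))
    rw [Nat.sum_totient] at h
    exact_mod_cast h
  -- `Σ 2^{ω(Dm)} = 2^{ω(D)} d(M²) = d(D M²)`
  have hω : ∑ m ∈ M.divisors, (2 : ℝ) ^ (D * m).primeFactors.card =
      ((D * M ^ 2).divisors.card : ℝ) := by
    have hmul : ∀ m ∈ M.divisors, 2 ^ (D * m).primeFactors.card =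
        2 ^ D.primeFactors.card * 2 ^ m.primeFactors.card := fun m hm ↦ by
      have hm0 : m ≠ 0 := (Nat.pos_of_mem_divisors hm).ne'
      rw [Nat.primeFactors_mul hD0 hm0, Finset.card_union_of_disjoint
        ((hDM.coprime_dvd_right (Nat.dvd_of_mem_divisors hm)).disjoint_primeFactors), pow_add]
    have h : ∑ m ∈ M.divisors, 2 ^ (D * m).primeFactors.card = (D * M ^ 2).divisors.card := by
      rw [Finset.sum_congr rfl hmul, ← Finset.mul_sum, sum_divisors_two_pow_card_primeFactors hM,
        ← card_divisors_of_squarefree' hD, ← Nat.Coprime.card_divisors_mul (hDM.pow_right 2)]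
    exact_mod_cast h
  -- `Σ μ(Dm) ≤ 1`
  have hμ : ∑ m ∈ M.divisors, (μ (D * m) : ℝ) ≤ 1 := sum_divisors_moebius_mul_le hDM
  linarith [h1, heq, hφ, hω, hμ]

/-- `n ≤ φ(n) d(n)`: `n = Σ_{d ∣ n} φ(d)` and `φ(d) ∣ φ(n)` for `d ∣ n`. [folklore] -/
private theorem self_le_totient_mul_card_divisors' (n : ℕ) : n ≤ n.totient * n.divisors.card := by
  rcases eq_or_ne n 0 with rfl | hn
  · simp
  calc n = ∑ d ∈ n.divisors, d.totient := (Nat.sum_totient n).symm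
    _ ≤ ∑ d ∈ n.divisors, n.totient := Finset.sum_le_sum fun d hd ↦
        Nat.le_of_dvd (Nat.totient_pos.2 (Nat.pos_of_ne_zero hn))
          (Nat.totient_dvd_of_dvd (Nat.dvd_of_mem_divisors hd))
    _ = n.totient * n.divisors.card := by rw [Finset.sum_const, smul_eq_mul, mul_comm]

/-- **Prop 7.1, the lower-order terms** (p. 26: "Thus, given `ε > 0`, for `N ≫_ε 1` with an
effective implicit constant, we have `r_{D,M} < (1/12 + ε)·φ(D)M`. (The asymptotic bound follows by
recalling that `φ(n) ≫ n/log log n`.)"): for `N = DM ≥ N₁(ε)` (`M ≠ 0`, `gcd(D, M) = 1`),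
`(7/12) d(DM²) + 1 ≤ ε φ(D) M`. Proof (crude but sufficient): the divisor bound `d(n) ≤ C n^{1/8}`
(`Sieve.exists_card_divisors_le_mul_rpow'`, Hardy–Wright Thm 315) gives `d(DM²) ≤ d(N²) ≤ C N^{1/4}`
and `φ(D)M ≥ φ(N) ≥ N/d(N) ≥ N^{3/4}/C`; take `√N ≥ (7C/12 + 1)C/ε`.
[cite: PastenShimura2024, Prop. 7.1 (p. 26, second display)] -/
theorem pasten2024_prop_7_1_lowerOrder_le {ε : ℝ} (hε : 0 < ε) :
    ∃ N₁ : ℕ, ∀ D M : ℕ, M ≠ 0 → D.Coprime M → N₁ ≤ D * M →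
      7 / 12 * ((D * M ^ 2).divisors.card : ℝ) + 1 ≤ ε * ((Nat.totient D : ℝ) * M) := by
  obtain ⟨C, hC1, hC⟩ := Sieve.exists_card_divisors_le_mul_rpow' (ε := 1 / 8) (by norm_num)
  have hC0 : 0 < C := one_pos.trans_le hC1
  set K : ℝ := (7 / 12 * C + 1) * C / ε with hK
  have hK0 : 0 ≤ K := by positivity
  refine ⟨⌈K ^ 2⌉₊ + 1, fun D M hM hDM hN ↦ ?_⟩
  have hD : D ≠ 0 := by rintro rfl; simp at hN
  set N : ℕ := D * M with hNdef
  have hN0 : N ≠ 0 := mul_ne_zero hD hM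
  have hN1 : (1 : ℝ) ≤ N := by exact_mod_cast Nat.one_le_iff_ne_zero.2 hN0
  have hNpos : (0 : ℝ) < N := one_pos.trans_le hN1
  set t : ℝ := (N : ℝ) ^ (1 / 4 : ℝ) with ht
  have ht1 : 1 ≤ t := Real.one_le_rpow hN1 (by norm_num)
  have ht0 : 0 < t := one_pos.trans_le ht1
  have hsq : K ≤ (N : ℝ) ^ (1 / 2 : ℝ) := by
    have h1 : K ^ 2 ≤ N := (Nat.le_ceil _).trans (by exact_mod_cast (Nat.le_succ _).trans hN)
    calc K = Real.sqrt (K ^ 2) := (Real.sqrt_sq hK0).symm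
      _ ≤ Real.sqrt N := Real.sqrt_le_sqrt h1
      _ = (N : ℝ) ^ (1 / 2 : ℝ) := Real.sqrt_eq_rpow _
  have h34 : (N : ℝ) ^ (1 / 2 : ℝ) * t = (N : ℝ) ^ (3 / 4 : ℝ) := by
    rw [ht, ← Real.rpow_add hNpos]; norm_num
  have h1434 : (N : ℝ) ^ (3 / 4 : ℝ) * t = N := by
    rw [ht, ← Real.rpow_add hNpos]; norm_num
  -- (1) `d(D M²) ≤ d(N²) ≤ C t`
  have hd : ((D * M ^ 2).divisors.card : ℝ) ≤ C * t := by
    have h1 : (D * M ^ 2).divisors.card ≤ (N ^ 2).divisors.card :=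
      Finset.card_le_card (Nat.divisors_subset_of_dvd (pow_ne_zero 2 hN0) ⟨D, by rw [hNdef]; ring⟩)
    have e : ((N ^ 2 : ℕ) : ℝ) ^ (1 / 8 : ℝ) = t := by
      rw [ht, Nat.cast_pow, ← Real.rpow_natCast, ← Real.rpow_mul hNpos.le]; norm_num
    calc ((D * M ^ 2).divisors.card : ℝ) ≤ ((N ^ 2).divisors.card : ℝ) := by exact_mod_cast h1
      _ ≤ C * ((N ^ 2 : ℕ) : ℝ) ^ (1 / 8 : ℝ) := hC (N ^ 2)
      _ = C * t := by rw [e]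
  -- (2) `N^{3/4} / C ≤ φ(N) ≤ φ(D) M`
  have hφ : (N : ℝ) ^ (3 / 4 : ℝ) / C ≤ (Nat.totient D : ℝ) * M := by
    have h1 : (N.totient : ℝ) ≤ (Nat.totient D : ℝ) * M := by
      have e : N.totient = D.totient * M.totient := by rw [hNdef, Nat.totient_mul hDM]
      rw [e, Nat.cast_mul]
      exact mul_le_mul_of_nonneg_left (by exact_mod_cast Nat.totient_le M) (Nat.cast_nonneg _)
    have h2 : (N : ℝ) ≤ (N.totient : ℝ) * (N.divisors.card : ℝ) := by
      exact_mod_cast self_le_totient_mul_card_divisors' N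
    have h3 : (N.divisors.card : ℝ) ≤ C * t :=
      (hC N).trans (mul_le_mul_of_nonneg_left
        (Real.rpow_le_rpow_of_exponent_le hN1 (by norm_num)) hC0.le)
    have h4 : (N : ℝ) ≤ (N.totient : ℝ) * (C * t) :=
      h2.trans (mul_le_mul_of_nonneg_left h3 (Nat.cast_nonneg _))
    have h5 : (N : ℝ) ^ (3 / 4 : ℝ) / C ≤ (N.totient : ℝ) := by
      rw [div_le_iff₀ hC0]
      refine le_of_mul_le_mul_right ?_ ht0
      calc (N : ℝ) ^ (3 / 4 : ℝ) * t = N := h1434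
        _ ≤ (N.totient : ℝ) * (C * t) := h4
        _ = (N.totient : ℝ) * C * t := by ring
    exact h5.trans h1
  -- (3) `(7/12) C t + 1 ≤ (7C/12 + 1) t = (ε/C) K t ≤ (ε/C) N^{1/2} t = ε N^{3/4} / C`
  have hKe : (7 / 12 * C + 1) = ε / C * K := by
    rw [hK]; field_simp
  calc 7 / 12 * ((D * M ^ 2).divisors.card : ℝ) + 1 ≤ 7 / 12 * (C * t) + 1 := by
        linarith [mul_le_mul_of_nonneg_left hd (by norm_num : (0 : ℝ) ≤ 7 / 12)]
    _ ≤ (7 / 12 * C + 1) * t := by nlinarith [ht1, hC0.le]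
    _ = ε / C * K * t := by rw [hKe]
    _ ≤ ε / C * (N : ℝ) ^ (1 / 2 : ℝ) * t := by gcongr
    _ = ε * ((N : ℝ) ^ (3 / 4 : ℝ) / C) := by rw [mul_assoc, h34]; ring
    _ ≤ ε * ((Nat.totient D : ℝ) * M) := mul_le_mul_of_nonneg_left hφ hε.le

/-- **Pasten 2024, Prop 7.1, asymptotic form** (p. 26, second display: *"Thus, given `ε > 0`, for
`N ≫_ε 1` with an effective implicit constant, we have `r_{D,M} < (1/12 + ε)·φ(D)M`"*), for an
arbitrary real sequence `s` with Martin's bound (`hs`) in place of `s(n) = dim S₂(n)^{new}` and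
`r_{D,M} = Σ_{m∣M} s(Dm)`: from `pasten2024_prop_7_1_of_martin_bound` and
`pasten2024_prop_7_1_lowerOrder_le`. [cite: PastenShimura2024, Prop. 7.1 (p. 26)] -/
theorem pasten2024_prop_7_1_asymptotic_of_martin_bound (s : ℕ → ℝ)
    (hs : ∀ n : ℕ, n ≠ 0 →
      s n ≤ (Nat.totient n : ℝ) / 12 + 7 / 12 * 2 ^ n.primeFactors.card + (μ n : ℝ))
    {ε : ℝ} (hε : 0 < ε) :
    ∃ N₁ : ℕ, ∀ D M : ℕ, Squarefree D → M ≠ 0 → D.Coprime M → N₁ ≤ D * M →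
      ∑ m ∈ M.divisors, s (D * m) < (1 / 12 + ε) * (Nat.totient D : ℝ) * M := by
  obtain ⟨N₁, hN₁⟩ := pasten2024_prop_7_1_lowerOrder_le (half_pos hε)
  refine ⟨N₁, fun D M hD hM hDM hN ↦ ?_⟩
  have h1 := pasten2024_prop_7_1_of_martin_bound s hs hD hM hDM
  have h2 := hN₁ D M hM hDM hN
  have hpos : (0 : ℝ) < (Nat.totient D : ℝ) * M := by
    have := Nat.totient_pos.2 (Nat.pos_of_ne_zero hD.ne_zero)
    have := Nat.pos_of_ne_zero hM
    positivity
  have hpos2 : 0 < ε * ((Nat.totient D : ℝ) * M) := mul_pos hε hpos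
  have e : (1 / 12 + ε) * (Nat.totient D : ℝ) * M =
      (Nat.totient D : ℝ) * M / 12 + ε * ((Nat.totient D : ℝ) * M) := by ring
  rw [e]
  linarith

end Prop71

end Literature.NumberTheory.EllipticCurves.ModularForms

end
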